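import Summits.QuantumFields.GaugeBoot.Rows.GLYZc2D3LTab
import HarnessLib

/-!
# Gauge-boot: kernel check of the raw `link1` class table, rows 0–93 (part 1/1)

Cell `pub-gaugeboot` (HOME `run/shared/lean/pub/pub-gaugeboot/`), seat lean1 (binding layer for rows C32–C33, C51–C60 = the certified
glyz-c2-rp-3D windows: label sets, class/witness tables, the reduction identity, soundness, per-β bindings).

HONEST FRAMING (page 1 of every file of this cell): certified bounds on lattice expectations at STATED coupling,
gauge group, dimension and torus size; NOT a mass gap, NOT a continuum limit, NOT a string tension, NOT large `N`.
The venture is explicitly NOT Yang–Mills-summit-bearing (barriers `FixedCouplingUltralocality`,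
`PerturbativeInvisibility`).

`lcanon_rows_<lo>_<hi> : ∀ i, lo ≤ i < hi → ∀ j ≥ i, LCanonOK i j`, each range one closed computation (`decide +kernel`);
assembled in `GLYZc2D3Canon`.
-/

noncomputable section

open Literature.MathematicalPhysics.QuantumFieldTheory

namespace Summit.QuantumFields.GaugeBoot

namespace GLYZc2D3

set_option maxHeartbeats 0 in
/-- Rows `0 ≤ i < 14` of the `link1` class table canonicalise (1225 entries; closed computation checked by the kernel). -/
theorem lcanon_rows_0_14 : ∀ i : Fin 94, 0 ≤ i.val → i.val < 14 → ∀ j : Fin 94, i.val ≤ j.val → LCanonOK i j := by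
  decide +kernel

set_option maxHeartbeats 0 in
/-- Rows `14 ≤ i < 30` of the `link1` class table canonicalise (1160 entries; closed computation checked by the kernel). -/
theorem lcanon_rows_14_30 : ∀ i : Fin 94, 14 ≤ i.val → i.val < 30 → ∀ j : Fin 94, i.val ≤ j.val → LCanonOK i j := by
  decide +kernel

set_option maxHeartbeats 0 in
/-- Rows `30 ≤ i < 52` of the `link1` class table canonicalise (1177 entries; closed computation checked by the kernel). -/
theorem lcanon_rows_30_52 : ∀ i : Fin 94, 30 ≤ i.val → i.val < 52 → ∀ j : Fin 94, i.val ≤ j.val → LCanonOK i j := by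
  decide +kernel

set_option maxHeartbeats 0 in
/-- Rows `52 ≤ i < 94` of the `link1` class table canonicalise (903 entries; closed computation checked by the kernel). -/
theorem lcanon_rows_52_94 : ∀ i : Fin 94, 52 ≤ i.val → i.val < 94 → ∀ j : Fin 94, i.val ≤ j.val → LCanonOK i j := by
  decide +kernel

end GLYZc2D3

end Summit.QuantumFields.GaugeBoot

end
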